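import Summits.Parity.GeneralizedHardyLittlewood.Theorems.LeeYangFibresCellParityLawBase
import Summits.Parity.GeneralizedHardyLittlewood.Theorems.LeeYangFibresAbsoluteUpgradeAnatomyAlong
import Summits.Parity.GeneralizedHardyLittlewood.Theorems.LeeYangFibresAbsoluteUpgradeQuantClipNumerics
import Summits.Parity.GeneralizedHardyLittlewood.Theorems.LeeYangFibresCellParityLawSavingBaseAux
import Summits.Parity.BatemanHorn.Theorems.RoughParitySectorsOddSectorShareNonlinearOddBuchstabMass
import Literature.NumberTheory.Sieve.RoughOmegaCellsClassesEquidistributionExplicit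
import Literature.NumberTheory.Sieve.RoughOmegaCellsLocalAPExplicit
import HarnessLib

/-!
# Route `LeeYangFibres`, crux `CellParityLawSaving` (stmt-Parity-18104), line `superpoly-band-same-atom`:
# the registered stub `stub_baseSavInlined` — the base `t = 1` of the law ALONG THE SCHEDULE

`--supports` file 2/2 of the stub `stub_baseSavInlined` of the skeleton
`Cruxes/CellParityLawSaving/Lines/SketchIdeator3.lean` (= `stub_baseSav : LawSavAt 1` with the vocabulary
unfolded). For one affine form `ψ(n) = a n + b` (`a ≠ 0`, `|a| + |b|/N ≤ L`) on a convex `K ⊆ [-N, N] ⊆ ℝ¹`,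
the rough `Ω`-cells `C_j = #{n ∈ K ∩ ℤ : P⁻(ψ(n)) > N^{1/U}, Ω(ψ(n)) = j}` at the roughness of the SCHEDULE
`U = U(N) = slowDegree N = max 4 ⌊√(log log N)/2⌋` satisfy, for all large `N` and ALL `1 ≤ j ≤ U(N)`,
`|C_j − β_∞ · 𝔖 · a_j| ≤ N/(log N)^{3/2}` (`δ = 1/2`), with the trivial Walsh amplitudes (`θ_∅ = 1`,
`θ_S = 0` otherwise), where `a_j = modelDensity N U j`, `β_∞ = archFactor Ψ K`, `𝔖 = singularProduct Ψ`.

It is a port of the sister crux's `stub_base : LawEffAt 1` (stmt-Parity-14109,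
`LeeYangFibresCellParityLawBase.lean`) along the schedule. There `u` and `j` were fixed before `N₀`; here
both move with `N`, and the proof runs on the explicit-constant versions of the two analytic inputs:

* Alladi's cell asymptotics with the rate `A₁^{i+k+1} X/log² Y` (`anatomyAlong_explicitCellRate`, landed
  for stmt-Parity-14116), read for the Literature densities through
  the landed dictionary `cellDensity i = I_{i+1}` on `[1, ∞)`
  (`oddMass_cellDensity_eq_roughCellDensity_succ`, file `RoughParitySectorsOddSectorShareNonlinearOddBuchstabMass`);
* the equidistribution of the cells in the reduced classes with the rate `A₃^n X/log² Y`
  (`RoughCellsAP.exists_abs_cellClassDisc_le_pow_of_le`);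

fed into the local law with explicit constants and thresholds
(`RoughCellsLocal.abs_cellClass_segment_sub_le_explicit`, error `K(U) N log log N/log² N` with
`K(U) = 2A₃^{U+1}LU² + 2(2A₁^{2U+1}LU² + 12UL + L + 1)`), and then into the one-scale law
`baseSav_cell_law_at`. Along the schedule `exp(4U²) ≤ log N` and `log log N ≤ (2U+2)²`
(`quantClip_schedule`), so `2 K(U) log log N ≤ exp(2U²) ≤ (log N)^{1/2}` for `U ≥ U₀`
(`BaseSavAux.schedule_numerics`), which is the saving `δ = 1/2`; the thresholds `L, e < N^{1/U}`,
`2L + 2 ≤ N^{1/U}` follow from `N^{1/U} = exp(log N/U) ≥ exp(4U) ≥ 1 + 4U` and `U ≥ L`.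

References: K. Alladi, Quart. J. Math. Oxford (2) 33 (1982) 129–148 [Alladi1982]; G. Tenenbaum,
*Introduction to analytic and probabilistic number theory*, III.6 [Tenenbaum2015].
-/

noncomputable section

open scoped BigOperators Classical ArithmeticFunction.Omega
open Finset Filter MeasureTheory Literature.NumberTheory.Sieve
open Summit.Parity.GeneralizedHardyLittlewood.Cruxes.CellParityLaw.SectionAnnihilator
open Summit.Parity.GeneralizedHardyLittlewood.Cruxes.AbsoluteUpgrade.DipMarginRateExchange (slowDegree
  four_le_slowDegree quantClip_schedule anatomyAlong_explicitCellRate)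
open Summit.Parity.BatemanHorn.Cruxes.OddSectorShareNonlinear.Birth
  (oddMass_cellDensity_eq_roughCellDensity_succ)

namespace Summit.Parity.GeneralizedHardyLittlewood.Cruxes.CellParityLawSaving.SuperPolyBand

/-! ## The law for one form along the schedule -/

/-- **The law for one form and every cell index along the schedule** (`δ = 1/2`): for `L ≥ 1` there is
`N₀` such that for all `N ≥ N₀`, all non-degenerate one-form systems `Ψ` of size `≤ L` at scale `N`, all
convex `K ⊆ [-N, N]` and ALL `1 ≤ j₀ ≤ U(N)`,
`|C_{j₀}(Ψ, K, N, U(N)) − β_∞(Ψ, K) 𝔖(Ψ) a_{j₀}(N, U(N))| ≤ N/(log N · (log N)^{1/2})`. -/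
theorem cell_law_along (L : ℕ) (hL : 1 ≤ L) :
    ∃ N₀ : ℕ, ∀ N : ℕ, N₀ ≤ N → ∀ Ψ : Fin 1 → AffLinForm 1, IsNondegenerateSystem Ψ →
      affLinSize Ψ N ≤ L → ∀ K : Set (Fin 1 → ℝ), Convex ℝ K → K ⊆ realBox 1 N →
      ∀ j₀ : ℕ, 1 ≤ j₀ → j₀ ≤ slowDegree N →
        |(cell Ψ K N (slowDegree N) (fun _ => j₀) : ℝ) -
            archFactor Ψ K * singularProduct Ψ * modelDensity N (slowDegree N) j₀| ≤
          (N : ℝ) / (Real.log N ^ 1 * Real.log N ^ (1 / 2 : ℝ)) := by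
  -- the constants of the two explicit inputs
  obtain ⟨A₁, hA₁2, hP1⟩ := anatomyAlong_explicitCellRate
  obtain ⟨A₃, hA₃1, hP3⟩ := RoughCellsAP.exists_abs_cellClassDisc_le_pow_of_le L
  have hA₁1 : 1 ≤ A₁ := by linarith
  -- the thresholds: in `U` (numerics of the constant) and in `N` (two `u`-free growth lemmas)
  obtain ⟨U₀, hU₀⟩ := BaseSavAux.schedule_numerics hA₁1 hA₃1 L
  obtain ⟨N₁, hN₁⟩ := quantClip_schedule U₀
  obtain ⟨N₂, hN₂⟩ := Filter.eventually_atTop.1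
    ((RoughCellsLocal.eventually_rpow_le_div_log_sq (le_refl 2)).and
      (RoughCellsLocal.eventually_mul_loglog_pow_le_log (4 + 2 * Real.log L) 1))
  refine ⟨max N₁ N₂, fun N hN Ψ hΨ hsize K hK hKN j₀ hj₀ hj₀U => ?_⟩
  obtain ⟨hU₀U, hN16, hexpU, hllU⟩ := hN₁ N (le_trans (le_max_left _ _) hN)
  obtain ⟨hzN2, hc4N⟩ := hN₂ N (le_trans (le_max_right _ _) hN)
  rw [pow_one] at hc4N
  obtain ⟨hLU, hnum⟩ := hU₀ (slowDegree N) hU₀U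
  have hU4 : 4 ≤ slowDegree N := four_le_slowDegree N
  -- freeze the roughness `U = U(N)`
  generalize slowDegree N = U at hU₀U hexpU hllU hLU hnum hU4 hj₀U ⊢
  obtain ⟨i, rfl⟩ : ∃ i, j₀ = i + 1 := ⟨j₀ - 1, by omega⟩
  obtain ⟨hll, hLll, hLz2, hLz', hez, hzN, hss, hexp2, h4L⟩ :=
    BaseSavAux.schedule_thresholds hL hU4 hLU hN16 hexpU hzN2
  have hN3 : 3 ≤ N := by omega
  have hN0 : (0 : ℝ) < N := by exact_mod_cast (by omega : 0 < N)
  have hlN1 : 1 ≤ Real.log N := by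
    have h := Real.add_one_le_exp (4 * (U : ℝ) ^ 2)
    nlinarith [sq_nonneg (U : ℝ)]
  have hs1 : 1 ≤ Real.log N ^ (1 / 2 : ℝ) :=
    le_trans (by have := Real.add_one_le_exp (2 * (U : ℝ) ^ 2); nlinarith [sq_nonneg (U : ℝ)]) hexp2
  -- the two explicit inputs for the cell `Ω = i + 1` at roughness `U`, constants `A₁^{2U+1}`, `A₃^{U+1}`
  have hUu : 2 ≤ U := by omega
  have hC₁0 : (0 : ℝ) ≤ A₁ ^ (2 * U + 1) := by positivity
  have hC₃0 : (0 : ℝ) ≤ A₃ ^ (U + 1) := by positivity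
  have hP1' : ∀ X Y : ℝ, 2 ≤ Y → Y ≤ X → Real.log X ≤ (U + 1 : ℕ) * Real.log Y →
      |(#((roughIcc ⌈Y⌉₊ ⌊X⌋₊).filter (fun b => Ω b = i + 1)) : ℝ) -
        (X * roughCellDensity (i + 1) (Real.log X / Real.log Y) / Real.log X -
          if i = 0 then Y / Real.log Y else 0)| ≤ A₁ ^ (2 * U + 1) * X / Real.log Y ^ 2 := by
    intro X Y hY hYX hXY
    have hlY : 0 < Real.log Y := Real.log_pos (by linarith)
    have hs : 1 ≤ Real.log X / Real.log Y := by
      rw [le_div_iff₀ hlY, one_mul]; exact Real.log_le_log (by linarith) hYX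
    have h := hP1 i (U + 1) X Y hY hYX hXY
    rw [oddMass_cellDensity_eq_roughCellDensity_succ i hs] at h
    refine h.trans ?_
    have hX0 : 0 ≤ X := by linarith
    rw [div_le_div_iff_of_pos_right (by positivity)]
    exact mul_le_mul_of_nonneg_right (pow_le_pow_right₀ hA₁1 (by omega)) hX0
  have hP3' : ∀ q : ℕ, 0 < q → q ≤ L → ∀ X Y : ℝ, 2 ≤ Y → Y ≤ X →
      Real.log X ≤ (U + 1 : ℕ) * Real.log Y → (q : ℝ) < Y → ∀ c : ℕ, c.Coprime q →
        |(#((roughIcc ⌈Y⌉₊ ⌊X⌋₊).filter (fun b => Ω b = i + 1 ∧ b ≡ c [MOD q])) : ℝ) -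
            (#((roughIcc ⌈Y⌉₊ ⌊X⌋₊).filter (fun b => Ω b = i + 1)) : ℝ) / Nat.totient q| ≤
          A₃ ^ (U + 1) * X / Real.log Y ^ 2 :=
    fun q hq hqL X Y hY hYX hXY hqY c hc => hP3 q hq hqL (U + 1) X Y hY hYX hXY hqY i c hc
  -- the explicit local law at this `N`
  have hloc := RoughCellsLocal.abs_cellClass_segment_sub_le_explicit (i := i) hUu hL hC₁0 hC₃0 hP1'
    hP3' hN3 hll hLll hLz' hez hzN hc4N
  -- the error budget: `2 K(U) log log N ≤ exp(2U²) ≤ (log N)^{1/2}`, so `E + 2L ≤ N/(log N)^{3/2}`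
  have hKll : 2 * (2 * A₃ ^ (U + 1) * L * (U : ℝ) ^ 2 +
      2 * (2 * A₁ ^ (2 * U + 1) * L * (U : ℝ) ^ 2 + 12 * U * L + L + 1)) * Real.log (Real.log N) ≤
        Real.log N ^ (1 / 2 : ℝ) :=
    le_trans (le_trans (mul_le_mul_of_nonneg_left hllU (by positivity)) hnum) hexp2
  have hER := BaseSavAux.budget hN0 hlN1 hs1 hss hKll h4L
  exact baseSav_cell_law_at hL (by omega) hLz2 (by positivity) hER hloc Ψ hΨ hsize K hK hKN

/-! ## The registered stub -/

/-- **`stub_baseSavInlined`** (registered stub of the line `superpoly-band-same-atom`, = `stub_baseSav :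
LawSavAt 1` with the vocabulary unfolded): the cell-parity law ALONG THE SCHEDULE `u = U(N)` with the saving
`(log N)^{-1/2}` for ONE affine form — with the Walsh amplitudes `θ_∅ = 1`, `θ_S = 0` (`S ≠ ∅`) the amplitude
factor is `1`, and the law is `cell_law_along` (for `L = 0` no form of size `≤ 0` is non-degenerate). -/
theorem stub_baseSavInlined : ∀ L : ℕ, ∃ δ : ℝ, 0 < δ ∧ ∃ N₀ : ℕ, ∀ N : ℕ, N₀ ≤ N → ∀ Ψ : Fin 1 → AffLinForm 1, IsNondegenerateSystem Ψ → affLinSize Ψ N ≤ L → ∀ K : Set (Fin 1 → ℝ), Convex ℝ K → K ⊆ realBox 1 N → ∃ θ : Finset (Fin 1) → ℝ, θ ∅ = 1 ∧ (∀ S, |θ S| ≤ 2) ∧ ∀ j : Fin 1 → ℕ, (∀ i, 1 ≤ j i ∧ j i ≤ slowDegree N) → |(cell Ψ K N (slowDegree N) j : ℝ) - walsh θ j * (archFactor Ψ K * singularProduct Ψ * ∏ i, modelDensity N (slowDegree N) (j i))| ≤ (N : ℝ) / (Real.log N ^ 1 * Real.log N ^ δ) := by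
  intro L
  refine ⟨1 / 2, by norm_num, ?_⟩
  rcases Nat.lt_or_ge L 1 with hL | hL
  · -- `L = 0`: no form of size `≤ 0` is non-degenerate
    refine ⟨0, fun N _ Ψ hΨ hsize K _ _ => ?_⟩
    exfalso
    apply hΨ.1 0
    have h : affLinSize Ψ N ≤ 0 := by
      have : (L : ℝ) = 0 := by exact_mod_cast (by omega : L = 0)
      rw [this] at hsize; exact hsize
    unfold affLinSize at h
    simp only [Fin.sum_univ_one] at h
    have h1 : |(((Ψ 0).coeff 0 : ℤ) : ℝ)| ≤ 0 := by linarith [abs_nonneg (((Ψ 0).const : ℝ) / N)]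
    have h2 : (Ψ 0).coeff 0 = 0 := by exact_mod_cast abs_nonpos_iff.mp h1
    funext k; rw [Fin.fin_one_eq_zero k]; exact h2
  obtain ⟨N₀, hN₀⟩ := cell_law_along L hL
  refine ⟨N₀, fun N hN Ψ hΨ hsize K hK hKN => ⟨fun S => if S = ∅ then 1 else 0, if_pos rfl, ?_, ?_⟩⟩
  · intro S; dsimp only; split_ifs <;> norm_num
  · intro j hj
    have hw : walsh (fun S : Finset (Fin 1) => if S = ∅ then (1 : ℝ) else 0) j = 1 := by
      unfold walsh
      rw [Finset.sum_eq_single_of_mem (∅ : Finset (Fin 1)) (Finset.mem_univ _)]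
      · simp
      · intro S _ hS; simp [hS]
    have hj' : j = fun _ => j 0 := by funext k; rw [Fin.fin_one_eq_zero k]
    rw [hw, one_mul, Fin.prod_univ_one, hj']
    exact hN₀ N hN Ψ hΨ hsize K hK hKN (j 0) (hj 0).1 (hj 0).2

end Summit.Parity.GeneralizedHardyLittlewood.Cruxes.CellParityLawSaving.SuperPolyBand

end
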